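import Summits.QuantumFields.YangMills.Theorems.SwapVirialDeficitTauberSandwichRpow
import HarnessLib

/-!
# The uniform two-sided Tauberian sandwich with a POWER remainder `κ·t^θ`, layer-cake (mixture) form
# (support of LINE «sharp-sigma» on crux ⟨stmt-QuantumFields-24197⟩ `SwapVirialDeficit.SwapGluedStiffness`: the σ-glued ring trace is the
# MIXTURE `(1/8)Σ_z ∫e^{−βF^S_z}` of eight sector Laplace transforms, so the Tauberian transfer is stated for the mixed state density
# `m(s) = (1/8)Σ_z μ_L{F^S_z ≤ s}` directly, with the power remainder `t^θ` of the swap small-ball law — ✓`Tauber.tauber_sandwich` has `κ·t` and one `F`)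

★★ `tauber_sandwich_rpow_layerCake`: for `0 ≤ m ≤ 1` with `|m(t)/(v·t^N) − 1| ≤ κ·t^θ` on `(0, t₀]` and `I = ∫_{s>0} βe^{−βs} m(s) ds`, on the
window `β ≥ 4`, `κ(N+2)β^{−θ} ≤ 1/4`, `64(N+2)²(1 + |log v| + |log t₀| + log β) ≤ β·t₀`: `|log I − (log v + log N! − N·log β)| ≤ 2κ(N+2)β^{−θ} + 2/β`.
Proof = ✓`tauber_sandwich` with the remainder `κ s^θ` bounded pointwise by Young's inequality ✓`rpow_le_rpow_neg_mul_linear` `s^θ ≤ β^{−θ}(βs + 1)`; truncation and far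
tails by ✓`window_truncation_tail` / ✓`window_far_tail`.
HONEST LABEL: pure real analysis; no crux, rung or summit statement is proved; the Yang–Mills mass gap is NOT proved; no summit is proved by a
line.  Seat ym-line-fcl-p3 g43 (cell ym-idea-1, free hands), `--supports stmt-QuantumFields-24197`.  THEOREMS ONLY, standard axioms.
References: [cite: Griffiths1964]; [folklore].
-/

set_option autoImplicit false

noncomputable section

namespace Summit.QuantumFields.YangMills.Theorems.SwapVirialDeficit.SharpSigma

open MeasureTheory Set Filter Real
open scoped Nat Topology
open Summit.QuantumFields.YangMills.Theorems.TwistEaterVolume.Tauber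

/-! ## The sandwich, layer-cake form (Young step = ✓`rpow_le_rpow_neg_mul_linear`) -/

/-- ★★ **UNIFORM TWO-SIDED TAUBERIAN SANDWICH, power remainder, LAYER-CAKE form**: for a function `0 ≤ m ≤ 1` (a state density, or a
finite mixture of state densities) with `|m(t)/(v·t^N) − 1| ≤ κ·t^θ` on `(0, t₀]` (`0 < θ ≤ 1`) whose Laplace layer cake
`I = ∫_{s>0} βe^{−βs} m(s) ds` converges, and every `β ≥ 4` with `κ(N+2)β^{−θ} ≤ 1/4` and `64(N+2)²(1 + |log v| + |log t₀| + log β) ≤ β·t₀`: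
`|log I − (log v + log N! − N·log β)| ≤ 2κ(N+2)β^{−θ} + 2/β`. [cite: Griffiths1964] -/
theorem tauber_sandwich_rpow_layerCake (m : ℝ → ℝ) (N : ℕ) (v κ θ t₀ : ℝ) (hm0 : ∀ s, 0 ≤ m s) (hm1 : ∀ s, m s ≤ 1) (hv : 0 < v)
    (ht₀ : 0 < t₀) (hκ : 0 ≤ κ) (hθ : 0 < θ) (hθ1 : θ ≤ 1)
    (hvol : ∀ t : ℝ, 0 < t → t ≤ t₀ → |m t / (v * t ^ N) - 1| ≤ κ * t ^ θ)
    {β : ℝ} (hβ4 : 4 ≤ β) (hβκ : κ * ((N : ℝ) + 2) * β ^ (-θ) ≤ 1 / 4)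
    (hwin : 64 * ((N : ℝ) + 2) ^ 2 * (1 + |Real.log v| + |Real.log t₀| + Real.log β) ≤ β * t₀)
    (hintgG : IntegrableOn (fun s : ℝ => β * rexp (-(β * s)) * m s) (Ioi 0)) :
    |Real.log (∫ s in Ioi 0, β * rexp (-(β * s)) * m s) - (Real.log v + Real.log (N ! : ℝ) - N * Real.log β)|
      ≤ 2 * κ * ((N : ℝ) + 2) * β ^ (-θ) + 2 / β := by
  have hβ2 : 2 ≤ β := by linarith
  have hβ : 0 < β := by linarith
  have hN0 : (0:ℝ) ≤ N := Nat.cast_nonneg N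
  have hfact_succ : ((N + 1) ! : ℝ) = (N + 1) * N ! := by
    push_cast [Nat.factorial_succ]; ring
  -- the remainder weight `A = κ β^{−θ}`
  set A : ℝ := κ * β ^ (-θ) with hA
  have hA0 : 0 ≤ A := by rw [hA]; exact mul_nonneg hκ (Real.rpow_nonneg hβ.le _)
  have hAN : A * ((N : ℝ) + 2) ≤ 1 / 4 := by rw [hA]; linarith [hβκ, show κ * β ^ (-θ) * ((N : ℝ) + 2) = κ * ((N : ℝ) + 2) * β ^ (-θ) by ring]
  have hA1 : A ≤ 1 := by nlinarith [hAN, hN0, hA0]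
  -- the pieces
  have hφN := integrableOn_pow_mul_exp_neg_mul_Ioi N hβ
  have hφN1 := integrableOn_pow_mul_exp_neg_mul_Ioi (N + 1) hβ
  -- split the layer-cake integral at `t₀`
  have hsplit : ∫ s in Ioi 0, β * rexp (-(β * s)) * m s
      = (∫ s in Ioc 0 t₀, β * rexp (-(β * s)) * m s)
        + ∫ s in Ioi t₀, β * rexp (-(β * s)) * m s := by
    rw [← setIntegral_union (Ioc_disjoint_Ioi le_rfl) measurableSet_Ioi
      (hintgG.mono_set Ioc_subset_Ioi_self) (hintgG.mono_set (Ioi_subset_Ioi ht₀.le)),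
      Ioc_union_Ioi_eq_Ioi ht₀.le]
  -- far tail: `0 ≤ J₂ ≤ e^{−βt₀}`
  have hJ2nn : 0 ≤ ∫ s in Ioi t₀, β * rexp (-(β * s)) * m s :=
    setIntegral_nonneg measurableSet_Ioi fun s _ =>
      mul_nonneg (by positivity) (hm0 s)
  have hJ2le : ∫ s in Ioi t₀, β * rexp (-(β * s)) * m s ≤ rexp (-(β * t₀)) := by
    calc ∫ s in Ioi t₀, β * rexp (-(β * s)) * m s
        ≤ ∫ s in Ioi t₀, β * rexp (-(β * s)) :=
          setIntegral_mono_on (hintgG.mono_set (Ioi_subset_Ioi ht₀.le))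
            (integrableOn_mul_exp_neg_mul_Ioi hβ t₀) measurableSet_Ioi
            fun s _ => mul_le_of_le_one_right (by positivity) (hm1 s)
      _ = rexp (-(β * t₀)) := integral_mul_exp_neg_mul_Ioi hβ t₀
  -- pointwise sandwich on `(0, t₀]`, the power remainder bounded by Young
  have hyoung : ∀ s ∈ Ioc (0:ℝ) t₀, κ * s ^ θ * (v * s ^ N) ≤ A * (v * s ^ N) + A * β * (v * s ^ (N + 1)) := by
    intro s hs
    have hs0 : 0 ≤ s := hs.1.le
    have hy := rpow_le_rpow_neg_mul_linear hs0 hβ hθ hθ1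
    have hvs : 0 ≤ v * s ^ N := by positivity
    calc κ * s ^ θ * (v * s ^ N) ≤ κ * (β ^ (-θ) * (β * s + 1)) * (v * s ^ N) :=
          mul_le_mul_of_nonneg_right (mul_le_mul_of_nonneg_left hy hκ) hvs
      _ = A * (v * s ^ N) + A * β * (v * s ^ (N + 1)) := by rw [hA]; ring
  have hup : ∀ s ∈ Ioc (0:ℝ) t₀, β * rexp (-(β * s)) * m s
      ≤ β * v * (1 + A) * (s ^ N * rexp (-(β * s))) + β * v * (A * β) * (s ^ (N + 1) * rexp (-(β * s))) := by
    intro s hs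
    have hvs : 0 < v * s ^ N := by have := hs.1; positivity
    have h := (abs_sub_le_iff.1 (hvol s hs.1 hs.2)).1
    rw [sub_le_iff_le_add, div_le_iff₀ hvs] at h
    have hg0 : 0 ≤ β * rexp (-(β * s)) := by positivity
    have hy := hyoung s hs
    calc β * rexp (-(β * s)) * m s
        ≤ β * rexp (-(β * s)) * ((κ * s ^ θ + 1) * (v * s ^ N)) := mul_le_mul_of_nonneg_left h hg0
      _ ≤ β * rexp (-(β * s)) * ((v * s ^ N) + (A * (v * s ^ N) + A * β * (v * s ^ (N + 1)))) := by
          refine mul_le_mul_of_nonneg_left ?_ hg0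
          nlinarith [hy]
      _ = β * v * (1 + A) * (s ^ N * rexp (-(β * s))) + β * v * (A * β) * (s ^ (N + 1) * rexp (-(β * s))) := by
          ring
  have hlo : ∀ s ∈ Ioc (0:ℝ) t₀,
      β * v * (1 - A) * (s ^ N * rexp (-(β * s))) - β * v * (A * β) * (s ^ (N + 1) * rexp (-(β * s)))
      ≤ β * rexp (-(β * s)) * m s := by
    intro s hs
    have hvs : 0 < v * s ^ N := by have := hs.1; positivity
    have h := (abs_sub_le_iff.1 (hvol s hs.1 hs.2)).2
    rw [sub_le_comm, le_div_iff₀ hvs] at h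
    have hg0 : 0 ≤ β * rexp (-(β * s)) := by positivity
    have hy := hyoung s hs
    calc β * v * (1 - A) * (s ^ N * rexp (-(β * s))) - β * v * (A * β) * (s ^ (N + 1) * rexp (-(β * s)))
        = β * rexp (-(β * s)) * ((v * s ^ N) - (A * (v * s ^ N) + A * β * (v * s ^ (N + 1)))) := by ring
      _ ≤ β * rexp (-(β * s)) * ((1 - κ * s ^ θ) * (v * s ^ N)) := by
          refine mul_le_mul_of_nonneg_left ?_ hg0
          nlinarith [hy]
      _ ≤ β * rexp (-(β * s)) * m s := mul_le_mul_of_nonneg_left h hg0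
  -- integrate the sandwich over `(0, t₀]`
  have hiN : IntegrableOn (fun s : ℝ => β * v * (1 + A) * (s ^ N * rexp (-(β * s)))) (Ioc 0 t₀) :=
    (hφN.mono_set Ioc_subset_Ioi_self).const_mul (β * v * (1 + A))
  have hiN' : IntegrableOn (fun s : ℝ => β * v * (1 - A) * (s ^ N * rexp (-(β * s)))) (Ioc 0 t₀) :=
    (hφN.mono_set Ioc_subset_Ioi_self).const_mul (β * v * (1 - A))
  have hiN1 : IntegrableOn (fun s : ℝ => β * v * (A * β) * (s ^ (N + 1) * rexp (-(β * s)))) (Ioc 0 t₀) :=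
    (hφN1.mono_set Ioc_subset_Ioi_self).const_mul (β * v * (A * β))
  have hiU : IntegrableOn (fun s : ℝ => β * v * (1 + A) * (s ^ N * rexp (-(β * s)))
      + β * v * (A * β) * (s ^ (N + 1) * rexp (-(β * s)))) (Ioc 0 t₀) := hiN.add hiN1
  have hiL : IntegrableOn (fun s : ℝ => β * v * (1 - A) * (s ^ N * rexp (-(β * s)))
      - β * v * (A * β) * (s ^ (N + 1) * rexp (-(β * s)))) (Ioc 0 t₀) := hiN'.sub hiN1
  have hJ1le : ∫ s in Ioc 0 t₀, β * rexp (-(β * s)) * m s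
      ≤ β * v * (1 + A) * (∫ s in Ioc 0 t₀, s ^ N * rexp (-(β * s)))
        + β * v * (A * β) * (∫ s in Ioc 0 t₀, s ^ (N + 1) * rexp (-(β * s))) := by
    have h := setIntegral_mono_on (hintgG.mono_set Ioc_subset_Ioi_self) hiU
      measurableSet_Ioc hup
    rw [integral_add hiN hiN1, integral_const_mul, integral_const_mul] at h
    exact h
  have hJ1ge : β * v * (1 - A) * (∫ s in Ioc 0 t₀, s ^ N * rexp (-(β * s)))
        - β * v * (A * β) * (∫ s in Ioc 0 t₀, s ^ (N + 1) * rexp (-(β * s)))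
      ≤ ∫ s in Ioc 0 t₀, β * rexp (-(β * s)) * m s := by
    have h := setIntegral_mono_on hiL (hintgG.mono_set Ioc_subset_Ioi_self)
      measurableSet_Ioc hlo
    rw [integral_sub hiN' hiN1, integral_const_mul, integral_const_mul] at h
    exact h
  -- Gamma-integral bounds on `(0, t₀]`
  have hA_N : ∫ s in Ioc 0 t₀, s ^ N * rexp (-(β * s)) ≤ N ! / β ^ (N + 1) := by
    rw [← intervalIntegral.integral_of_le ht₀.le]
    exact intervalIntegral_pow_mul_exp_neg_le ht₀.le hβ
  have hA_Nnn : 0 ≤ ∫ s in Ioc 0 t₀, s ^ N * rexp (-(β * s)) :=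
    setIntegral_nonneg measurableSet_Ioc fun s hs => mul_nonneg (pow_nonneg hs.1.le _) (Real.exp_pos _).le
  have hA_N1 : ∫ s in Ioc 0 t₀, s ^ (N + 1) * rexp (-(β * s)) ≤ (N + 1) ! / β ^ (N + 1 + 1) := by
    rw [← intervalIntegral.integral_of_le ht₀.le]
    exact intervalIntegral_pow_mul_exp_neg_le ht₀.le hβ
  have h2N : 2 * (N:ℝ) ≤ β * t₀ := window_two_mul_le hβ2 hwin
  have hA_Nge : N ! / β ^ (N + 1) - 2 / β * t₀ ^ N * rexp (-(β * t₀ / 2))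
      ≤ ∫ s in Ioc 0 t₀, s ^ N * rexp (-(β * s)) := by
    have hsplit' : ∫ s in Ioi 0, s ^ N * rexp (-(β * s))
        = (∫ s in Ioc 0 t₀, s ^ N * rexp (-(β * s))) + ∫ s in Ioi t₀, s ^ N * rexp (-(β * s)) := by
      rw [← setIntegral_union (Ioc_disjoint_Ioi le_rfl) measurableSet_Ioi
        (hφN.mono_set Ioc_subset_Ioi_self) (hφN.mono_set (Ioi_subset_Ioi ht₀.le)),
        Ioc_union_Ioi_eq_Ioi ht₀.le]
    have htail := integral_Ioi_pow_mul_exp_neg_mul_le N hβ ht₀ h2N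
    have hfull := integral_pow_mul_exp_neg_mul_Ioi N hβ
    linarith
  -- window consequences
  have hW1 := window_far_tail (N := N) hv hβ2 hwin
  have hW2 := window_truncation_tail (N := N) hv ht₀ hβ2 hwin
  -- algebra: everything in units of `M = v·N!/β^N`
  obtain ⟨M, hM⟩ : ∃ M : ℝ, M = v * N ! / β ^ N := ⟨_, rfl⟩
  have hMpos : 0 < M := by rw [hM]; positivity
  rw [← hM] at hW1 hW2
  have hE1 : β * v * (N ! / β ^ (N + 1)) = M := by
    rw [hM]; field_simp; ring
  have hE2 : β * v * (A * β) * ((N + 1) ! / β ^ (N + 1 + 1)) = M * (A * (N + 1)) := by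
    rw [hM, hfact_succ]; field_simp; ring
  have hE3 : β * v * (2 / β * t₀ ^ N * rexp (-(β * t₀ / 2)))
      = 2 * v * t₀ ^ N * rexp (-(β * t₀ / 2)) := by
    field_simp
  obtain ⟨δ, hδ⟩ : ∃ δ : ℝ, δ = A * ((N : ℝ) + 2) + 1 / β := ⟨_, rfl⟩
  have hβinv : 1 / β ≤ 1 / 4 := one_div_le_one_div_of_le (by norm_num) hβ4
  have hδ0 : 0 ≤ δ := by rw [hδ]; positivity
  have hδhalf : δ ≤ 1 / 2 := by rw [hδ]; linarith [hAN, hβinv]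
  have hMβ : M / β = M * (1 / β) := by ring
  -- upper bound `I ≤ M(1+δ)`
  have hU : ∫ s in Ioi 0, β * rexp (-(β * s)) * m s ≤ M * (1 + δ) := by
    have h1 : β * v * (1 + A) * (∫ s in Ioc 0 t₀, s ^ N * rexp (-(β * s))) ≤ β * v * (1 + A) * (N ! / β ^ (N + 1)) :=
      mul_le_mul_of_nonneg_left hA_N (by positivity)
    have h2 : β * v * (A * β) * (∫ s in Ioc 0 t₀, s ^ (N + 1) * rexp (-(β * s)))
        ≤ β * v * (A * β) * ((N + 1) ! / β ^ (N + 1 + 1)) :=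
      mul_le_mul_of_nonneg_left hA_N1 (by positivity)
    have he1 : β * v * (1 + A) * (N ! / β ^ (N + 1)) = M * (1 + A) := by rw [← hE1]; ring
    have hexp : M * (1 + A) + M * (A * (N + 1)) + M / β = M * (1 + δ) := by rw [hδ]; ring
    rw [hsplit]
    linarith [hJ1le, hJ2le, h1, h2, he1, hE2, hW1, hexp]
  -- lower bound `M(1−δ) ≤ I`
  have hL : M * (1 - δ) ≤ ∫ s in Ioi 0, β * rexp (-(β * s)) * m s := by
    have h1A : 0 ≤ β * v * (1 - A) := mul_nonneg (by positivity) (by linarith)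
    have h1 : β * v * (1 - A) * (N ! / β ^ (N + 1) - 2 / β * t₀ ^ N * rexp (-(β * t₀ / 2)))
        ≤ β * v * (1 - A) * (∫ s in Ioc 0 t₀, s ^ N * rexp (-(β * s))) :=
      mul_le_mul_of_nonneg_left hA_Nge h1A
    have h2 : β * v * (A * β) * (∫ s in Ioc 0 t₀, s ^ (N + 1) * rexp (-(β * s)))
        ≤ β * v * (A * β) * ((N + 1) ! / β ^ (N + 1 + 1)) :=
      mul_le_mul_of_nonneg_left hA_N1 (by positivity)
    have hdist : β * v * (1 - A) * (N ! / β ^ (N + 1) - 2 / β * t₀ ^ N * rexp (-(β * t₀ / 2)))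
        = (1 - A) * (β * v * (N ! / β ^ (N + 1))) - (1 - A) * (β * v * (2 / β * t₀ ^ N * rexp (-(β * t₀ / 2)))) := by
      ring
    have htr : (1 - A) * (2 * v * t₀ ^ N * rexp (-(β * t₀ / 2))) ≤ M / β := by
      have h0 : 0 ≤ 2 * v * t₀ ^ N * rexp (-(β * t₀ / 2)) := by positivity
      calc (1 - A) * (2 * v * t₀ ^ N * rexp (-(β * t₀ / 2))) ≤ 1 * (2 * v * t₀ ^ N * rexp (-(β * t₀ / 2))) :=
            mul_le_mul_of_nonneg_right (by linarith) h0
        _ ≤ M / β := by rw [one_mul]; exact hW2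
    have hexp : (1 - A) * M - M / β - M * (A * (N + 1)) = M * (1 - δ) := by rw [hδ]; ring
    rw [hsplit]
    rw [hdist, hE1, hE3] at h1
    linarith [hJ1ge, hJ2nn, h1, h2, hE2, htr, hexp]
  -- logs
  have key := abs_log_sub_log_le_of_sandwich hMpos hδ0 hδhalf hL hU
  have hlogM : Real.log M = Real.log v + Real.log (N ! : ℝ) - N * Real.log β := by
    rw [hM, Real.log_div (by positivity) (by positivity), Real.log_mul hv.ne' (by positivity),
      Real.log_pow]
  have h2δ : 2 * δ = 2 * κ * ((N : ℝ) + 2) * β ^ (-θ) + 2 / β := by rw [hδ, hA]; ring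
  rw [← hlogM, ← h2δ]
  exact key

end Summit.QuantumFields.YangMills.Theorems.SwapVirialDeficit.SharpSigma

end
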